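import Summits.SmoothPoincare4.SmoothPoincare4.Theses.EntropyRung
import Summits.SmoothPoincare4.SmoothPoincare4.Theorems.EntropyRungSubcylindricalExistenceEntropyLocalisation
import Literature.Geometry.Lorentzian.VolumeChartIntegral
import Mathlib.Analysis.SpecialFunctions.JapaneseBracket
import Mathlib.MeasureTheory.Measure.Haar.NormedSpace
import HarnessLib

/-!
# The volume of the capped metric grows like `K²`
(crux stmt-SmoothPoincare4-10871 `EntropyRung.SubcylindricalExistence`, line
`green-blowup-conformal-entropy`, stub S5 `stub_capMetricVolume` of lead c2's skeleton)

Let `(g, p, G)` be Green data on a closed `4`-manifold `M` in the flat gauge at `p`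
(`φ = extChartAt (𝓡 4) p`, `y₀ = φ p`, the closed chart ball `B̄(y₀, r) ⊆ φ.target`, `φ⁻¹` a
`g`-isometry on it, and `G(φ⁻¹ y) = a/‖y − y₀‖²` on `B̄(y₀, r) ∖ {y₀}`), and assume (S0b, by text)
that the Riemannian measure of the chart ball is Lebesgue measure:
`∫_{φ⁻¹ B̄} F dV_g = ∫_{B̄} F ∘ φ⁻¹ dy` for continuous `F`. Then there are constants `C₁, C₂`
(depending on `M, g, p, G, a, r` only) such that for every `K > 0` and every smooth `ψ` with
`ψ = 4KG/(4K + G)` off `p` and `ψ(p) = 4K`,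

  `Vol(ψ² g) = ∫_M ψ⁴ dV_g ≤ C₁ + C₂ K²`.

Proof. Split `M` into the chart ball `B = φ⁻¹ B̄(y₀, r)` and its complement.
* Off `B` (indeed off the OPEN chart ball `U ⊆ B`, whose complement is compact and misses `p`)
  `G` is continuous, hence `|G| ≤ C`; and `0 ≤ ψ = 4KG/(4K+G) ≤ G ≤ C` off `p`, so
  `∫_{Bᶜ} ψ⁴ ≤ C⁴ · Vol_g(M) =: C₁` (the Riemannian measure of a compact manifold is finite).
* On `B`, by S0b, `∫_B ψ⁴ dV_g = ∫_{B̄} ψ(φ⁻¹ y)⁴ dy`, and `ψ(φ⁻¹ y) = 4Ka/(4K‖y − y₀‖² + a)` on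
  the whole closed ball (at `y = y₀` both sides are `4K`). With `R = √(4K/a)` the profile is
  `(4K)⁴ k(R (y − y₀))` for the kernel `k(w) = (1 + ‖w‖²)⁻⁴`, integrable on `ℝ⁴`
  (`integrable_rpow_neg_one_add_norm_sq`), so by translation and scaling invariance of Lebesgue
  measure `∫_{B̄} ≤ (4K)⁴ R⁻⁴ ∫_{ℝ⁴} k = 16 a² (∫ k) K²`; `C₂ := 16 a² ∫_{ℝ⁴} (1 + ‖w‖²)⁻⁴ dw`
  (of the order of `Vol(S⁴_{√(aK)}) = (8π²/3) a² K²`, the round sphere the cap closes up to).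

References: [LeeParker1987] §6 (the conformal blow-up `G^{4/(n−2)} g` and its asymptotics) and
§7 (Schoen's test functions). Everything below is elementary measure theory; everything is
proved; no definition, no named fact.
-/

noncomputable section

-- the registered namespace `Summit.SmoothPoincare4.SmoothPoincare4.Theorems` repeats a component
set_option linter.dupNamespace false

open scoped Manifold ContDiff Topology RealInnerProductSpace
open Set Filter MeasureTheory
open Literature.Geometry.Lorentzian

namespace Summit.SmoothPoincare4.SmoothPoincare4.Theorems

namespace CapMetricVolume

/-! ### The Euclidean profile `(4Ka/(4K‖y − y₀‖² + a))⁴` -/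

/-- The kernel `(1 + ‖w‖²)⁻⁴` is Lebesgue-integrable on `ℝ⁴` (decay `‖w‖⁻⁸`, `8 > 4`).
[folklore] -/
theorem integrable_capKernel :
    Integrable (fun w : EuclideanSpace ℝ (Fin 4) ↦ ((1 + ‖w‖ ^ 2) ^ 4)⁻¹) := by
  have h := integrable_rpow_neg_one_add_norm_sq (E := EuclideanSpace ℝ (Fin 4)) (μ := volume)
    (r := 8) (by rw [finrank_euclideanSpace_fin]; norm_num)
  refine h.congr (ae_of_all _ fun w ↦ ?_)
  have h1 : (0 : ℝ) ≤ 1 + ‖w‖ ^ 2 := by positivity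
  simp only
  rw [show (-8 / 2 : ℝ) = -((4 : ℕ) : ℝ) by norm_num, Real.rpow_neg h1, Real.rpow_natCast]

/-- The cap profile in scaled form: with `R² = 4K/a`,
`(4K)⁴ (1 + (R d)²)⁻⁴ = (4Ka/(4K d² + a))⁴`. [folklore] -/
theorem capProfile_eq {a K R d : ℝ} (ha : 0 < a) (hK : 0 < K) (hR2 : R ^ 2 = 4 * K / a) :
    (4 * K) ^ 4 * ((1 + (R * d) ^ 2) ^ 4)⁻¹ = (4 * K * a / (4 * K * d ^ 2 + a)) ^ 4 := by
  have hden : 4 * K * d ^ 2 + a ≠ 0 := by positivity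
  have h1 : 1 + (R * d) ^ 2 = (4 * K * d ^ 2 + a) / a := by
    rw [mul_pow, hR2]
    field_simp
    ring
  rw [h1, div_pow, inv_div, div_pow]
  ring

/-- **The Euclidean estimate.** If `0 ≤ f ≤ (4Ka/(4K‖y − y₀‖² + a))⁴` on a measurable set `s`
of `ℝ⁴` (`a, K > 0`), then `∫_s f ≤ 16 a² (∫_{ℝ⁴} (1 + ‖w‖²)⁻⁴ dw) K²`: bound by the integral
of the majorant over all of `ℝ⁴` and rescale by `R = √(4K/a)` after translating `y₀` to the
origin. [folklore] -/
theorem setIntegral_le_of_le_capProfile (y₀ : EuclideanSpace ℝ (Fin 4)) {a K : ℝ} (ha : 0 < a)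
    (hK : 0 < K) {s : Set (EuclideanSpace ℝ (Fin 4))} (hs : MeasurableSet s)
    (f : EuclideanSpace ℝ (Fin 4) → ℝ) (hf0 : ∀ y ∈ s, 0 ≤ f y)
    (hf : ∀ y ∈ s, f y ≤ (4 * K * a / (4 * K * ‖y - y₀‖ ^ 2 + a)) ^ 4) :
    ∫ y in s, f y ≤
      16 * a ^ 2 * (∫ w : EuclideanSpace ℝ (Fin 4), ((1 + ‖w‖ ^ 2) ^ 4)⁻¹) * K ^ 2 := by
  set R : ℝ := Real.sqrt (4 * K / a) with hR
  have hRpos : 0 < R := Real.sqrt_pos.2 (by positivity)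
  have hR2 : R ^ 2 = 4 * K / a := Real.sq_sqrt (by positivity)
  -- the kernel and the majorant
  set k : EuclideanSpace ℝ (Fin 4) → ℝ := fun w ↦ ((1 + ‖w‖ ^ 2) ^ 4)⁻¹ with hk
  set F : EuclideanSpace ℝ (Fin 4) → ℝ := fun y ↦ (4 * K) ^ 4 * k (R • (y - y₀)) with hF
  have hFeq : ∀ y, F y = (4 * K * a / (4 * K * ‖y - y₀‖ ^ 2 + a)) ^ 4 := by
    intro y
    simp only [hF, hk, norm_smul, Real.norm_eq_abs, abs_of_pos hRpos]
    exact capProfile_eq ha hK hR2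
  have hkint : Integrable k := integrable_capKernel
  have hFint : Integrable F :=
    ((hkint.comp_smul hRpos.ne').comp_sub_right y₀).const_mul ((4 * K) ^ 4)
  have hFnn : ∀ y, 0 ≤ F y := fun y ↦ by rw [hFeq]; positivity
  calc ∫ y in s, f y ≤ ∫ y in s, F y := by
        refine integral_mono_of_nonneg ?_ hFint.integrableOn ?_
        · exact (ae_restrict_iff' hs).2 (ae_of_all _ fun y hy ↦ hf0 y hy)
        · exact (ae_restrict_iff' hs).2
            (ae_of_all _ fun y hy ↦ (hf y hy).trans_eq (hFeq y).symm)
    _ ≤ ∫ y, F y := setIntegral_le_integral hFint (ae_of_all _ hFnn)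
    _ = (4 * K) ^ 4 * ∫ y, k (R • (y - y₀)) := integral_const_mul _ _
    _ = (4 * K) ^ 4 * ∫ y, k (R • y) := by
        rw [integral_sub_right_eq_self (fun y ↦ k (R • y)) y₀]
    _ = (4 * K) ^ 4 * ((R ^ 4)⁻¹ * ∫ w, k w) := by
        rw [Measure.integral_comp_smul volume k R, finrank_euclideanSpace_fin, smul_eq_mul,
          abs_of_pos (by positivity)]
    _ = 16 * a ^ 2 * (∫ w, k w) * K ^ 2 := by
        rw [show R ^ 4 = (R ^ 2) ^ 2 by ring, hR2]
        field_simp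
        ring

end CapMetricVolume

open CapMetricVolume

/-- **Workhorse of S5.** Green data `(g, p, G)` in the flat gauge at `p` with parameters `a, r`,
and the chart-ball volume identity S0b for this ball: there are `C₁, C₂` such that every smooth
`ψ` with `ψ = 4KG/(4K+G)` off `p` and `ψ p = 4K` (`K > 0`) has `∫ ψ⁴ dV_g ≤ C₁ + C₂ K²`.
Here `C₁ = C⁴ Vol_g(M)` with `|G| ≤ C` off the open chart ball, and
`C₂ = 16 a² ∫_{ℝ⁴} (1 + ‖w‖²)⁻⁴ dw`. [folklore] -/
theorem capMetricVolume_le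
    {M : Type} [TopologicalSpace M]
    [ChartedSpace (EuclideanSpace ℝ (Fin 4)) M] [IsManifold (𝓡 4) ∞ M] [CompactSpace M]
    [T3Space M] [MeasurableSpace M] [BorelSpace M]
    (g : PseudoRiemannianMetric (𝓡 4) ∞ (EuclideanSpace ℝ (Fin 4)) (TangentSpace (𝓡 4) : M → Type _))
    (hg : g.IsRiemannian) (p : M) (G : M → ℝ)
    (hGs : ContMDiffOn (𝓡 4) 𝓘(ℝ, ℝ) ∞ G {p}ᶜ) (hGpos : ∀ x, x ≠ p → 0 < G x)
    {a r : ℝ} (ha : 0 < a) (hr : 0 < r)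
    (hsub : Metric.closedBall (extChartAt (𝓡 4) p p) r ⊆ (extChartAt (𝓡 4) p).target)
    (hGa : ∀ y ∈ Metric.closedBall (extChartAt (𝓡 4) p p) r, y ≠ extChartAt (𝓡 4) p p →
      G ((extChartAt (𝓡 4) p).symm y) = a / ‖y - extChartAt (𝓡 4) p p‖ ^ 2)
    (hS0b : ∀ F : M → ℝ, Continuous F →
      ∫ x in {x | x ∈ (extChartAt (𝓡 4) p).source ∧
          extChartAt (𝓡 4) p x ∈ Metric.closedBall (extChartAt (𝓡 4) p p) r}, F x
          ∂(riemannianMeasure (g.toContMDiffRiemannianMetric hg)) =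
        ∫ y in Metric.closedBall (extChartAt (𝓡 4) p p) r, F ((extChartAt (𝓡 4) p).symm y)) :
    ∃ C₁ C₂ : ℝ, ∀ (K : ℝ), 0 < K → ∀ (ψ : M → ℝ), ContMDiff (𝓡 4) 𝓘(ℝ, ℝ) ∞ ψ →
      (∀ x, x ≠ p → ψ x = 4 * K * G x / (4 * K + G x)) → ψ p = 4 * K →
      ∫ x, (ψ x) ^ 4 ∂(riemannianMeasure (g.toContMDiffRiemannianMetric hg)) ≤ C₁ + C₂ * K ^ 2 := by
  set φ := extChartAt (𝓡 4) p with hφ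
  set y₀ := φ p with hy₀
  set μ : Measure M := riemannianMeasure (g.toContMDiffRiemannianMetric hg) with hμ
  haveI : IsFiniteMeasure μ := isFiniteMeasure_riemannianMeasure _
  -- the closed chart ball `B` and the open chart ball `U ⊆ B` (`p ∈ U`)
  set B : Set M := {x | x ∈ φ.source ∧ φ x ∈ Metric.closedBall y₀ r} with hB
  have hBm : MeasurableSet B := by
    change MeasurableSet (φ.source ∩ φ ⁻¹' Metric.closedBall y₀ r)
    exact measurableSet_source_inter_preimage_extChartAt p Metric.isClosed_closedBall.measurableSet
  set U : Set M := φ.source ∩ φ ⁻¹' Metric.ball y₀ r with hU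
  have hUo : IsOpen U := isOpen_extChartAt_preimage' p Metric.isOpen_ball
  have hUB : U ⊆ B := fun x hx ↦ ⟨hx.1, Metric.ball_subset_closedBall hx.2⟩
  have hpU : p ∈ U := ⟨mem_extChartAt_source p, Metric.mem_ball_self hr⟩
  have hpB : p ∈ B := hUB hpU
  -- `|G| ≤ C` on the compact set `Uᶜ ⊆ M ∖ {p}`
  have hUc : IsCompact Uᶜ := hUo.isClosed_compl.isCompact
  have hGcont : ContinuousOn G Uᶜ :=
    hGs.continuousOn.mono (compl_subset_compl.2 (singleton_subset_iff.2 hpU))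
  obtain ⟨C, hC⟩ := hUc.exists_bound_of_continuousOn hGcont
  refine ⟨C ^ 4 * μ.real univ,
    16 * a ^ 2 * (∫ w : EuclideanSpace ℝ (Fin 4), ((1 + ‖w‖ ^ 2) ^ 4)⁻¹), ?_⟩
  intro K hK ψ hψ hψG hψp
  have hψ4c : Continuous fun x ↦ ψ x ^ 4 := hψ.continuous.pow 4
  have hint : Integrable (fun x ↦ ψ x ^ 4) μ :=
    EntropyLocalisation.integrable_of_continuous g hg hψ4c
  -- (i) off the chart ball: `0 ≤ ψ ≤ G ≤ C`
  have h1 : ∫ x in Bᶜ, ψ x ^ 4 ∂μ ≤ C ^ 4 * μ.real univ := by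
    have hle : ∀ x ∈ Bᶜ, ‖ψ x ^ 4‖ ≤ C ^ 4 := by
      intro x hx
      have hxp : x ≠ p := fun h ↦ hx (h ▸ hpB)
      have hxU : x ∈ Uᶜ := fun h ↦ hx (hUB h)
      have hGx : 0 < G x := hGpos x hxp
      have hGC : G x ≤ C := (Real.le_norm_self _).trans (hC x hxU)
      have hψx : ψ x = 4 * K * G x / (4 * K + G x) := hψG x hxp
      have hψ0 : 0 ≤ ψ x := by rw [hψx]; positivity
      have hψle : ψ x ≤ G x := by
        rw [hψx, div_le_iff₀ (by positivity)]
        nlinarith [sq_nonneg (G x)]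
      rw [Real.norm_eq_abs, abs_of_nonneg (by positivity)]
      exact pow_le_pow_left₀ hψ0 (hψle.trans hGC) 4
    calc ∫ x in Bᶜ, ψ x ^ 4 ∂μ ≤ ‖∫ x in Bᶜ, ψ x ^ 4 ∂μ‖ := Real.le_norm_self _
      _ ≤ C ^ 4 * μ.real Bᶜ := norm_setIntegral_le_of_norm_le_const (measure_lt_top μ _) hle
      _ ≤ C ^ 4 * μ.real univ :=
          mul_le_mul_of_nonneg_left (measureReal_mono (subset_univ _)) (by positivity)
  -- (ii) on the chart ball: S0b and the Euclidean estimate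
  have h2 : ∫ x in B, ψ x ^ 4 ∂μ ≤
      16 * a ^ 2 * (∫ w : EuclideanSpace ℝ (Fin 4), ((1 + ‖w‖ ^ 2) ^ 4)⁻¹) * K ^ 2 := by
    rw [hS0b _ hψ4c]
    refine setIntegral_le_of_le_capProfile y₀ ha hK measurableSet_closedBall
      (fun y ↦ ψ (φ.symm y) ^ 4) (fun y _ ↦ by positivity) fun y hy ↦ ?_
    have hprof : ψ (φ.symm y) = 4 * K * a / (4 * K * ‖y - y₀‖ ^ 2 + a) := by
      by_cases hyy : y = y₀
      · rw [hyy, hy₀, hφ, extChartAt_to_inv p, hψp, sub_self, norm_zero, zero_pow two_ne_zero,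
          mul_zero, zero_add, mul_div_assoc, div_self ha.ne', mul_one]
      · have hyt : y ∈ φ.target := hsub hy
        have hxp : φ.symm y ≠ p := by
          intro h
          exact hyy ((φ.right_inv hyt).symm.trans (by rw [h]))
        have hd : ‖y - y₀‖ ≠ 0 := norm_ne_zero_iff.2 (sub_ne_zero.2 hyy)
        have h4 : 4 * K + a / ‖y - y₀‖ ^ 2 ≠ 0 := by positivity
        have h5 : 4 * K * ‖y - y₀‖ ^ 2 + a ≠ 0 := by positivity
        rw [hψG _ hxp, hGa y hy hyy, div_eq_div_iff h4 h5]
        field_simp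
    rw [hprof]
  -- assemble
  rw [← integral_add_compl hBm hint]
  linarith

/-- **S5 — the volume of the capped metric grows like `K²`** (registered form). Flat gauge at
`p`, Green data `(g, p, G)`; assume S0b (by text: the Riemannian measure of the flat chart ball is
Lebesgue measure). There are `C₁, C₂` (independent of `K`) such that every smooth `ψ` with
`ψ = 4KG/(4K+G)` off `p` and `ψ p = 4K` (`K > 0`) has `∫ ψ⁴ dV_g ≤ C₁ + C₂ K²`
(`Vol(ψ²g) ~ Vol(S⁴_{√(aK)}) = (8π²/3) a²K²`). [folklore] -/
theorem stub_capMetricVolume :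
    -- S0b (by text)
    (∀ (M : Type) [TopologicalSpace M] [T2Space M] [SecondCountableTopology M]
      [ChartedSpace (EuclideanSpace ℝ (Fin 4)) M] [IsManifold (𝓡 4) ∞ M] [CompactSpace M]
      [T3Space M] [MeasurableSpace M] [BorelSpace M]
      (g : PseudoRiemannianMetric (𝓡 4) ∞ (EuclideanSpace ℝ (Fin 4)) (TangentSpace (𝓡 4) : M → Type _))
      [g.HasLeviCivita] (hg : g.IsRiemannian) (p : M) (r : ℝ), 0 < r →
      Metric.closedBall (extChartAt (𝓡 4) p p) r ⊆ (extChartAt (𝓡 4) p).target →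
      (∀ y ∈ Metric.closedBall (extChartAt (𝓡 4) p p) r, ∀ X W : EuclideanSpace ℝ (Fin 4),
        g.val ((extChartAt (𝓡 4) p).symm y)
          (mfderiv 𝓘(ℝ, EuclideanSpace ℝ (Fin 4)) (𝓡 4) (extChartAt (𝓡 4) p).symm y X)
          (mfderiv 𝓘(ℝ, EuclideanSpace ℝ (Fin 4)) (𝓡 4) (extChartAt (𝓡 4) p).symm y W) = ⟪X, W⟫) →
      ∀ F : M → ℝ, Continuous F →
        ∫ x in {x | x ∈ (extChartAt (𝓡 4) p).source ∧
            extChartAt (𝓡 4) p x ∈ Metric.closedBall (extChartAt (𝓡 4) p p) r}, F x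
            ∂(riemannianMeasure (g.toContMDiffRiemannianMetric hg)) =
          ∫ y in Metric.closedBall (extChartAt (𝓡 4) p p) r, F ((extChartAt (𝓡 4) p).symm y)) →
    ∀ (M : Type) [TopologicalSpace M] [T2Space M] [SecondCountableTopology M]
      [ChartedSpace (EuclideanSpace ℝ (Fin 4)) M] [IsManifold (𝓡 4) ∞ M] [CompactSpace M]
      [T3Space M] [MeasurableSpace M] [BorelSpace M]
      (g : PseudoRiemannianMetric (𝓡 4) ∞ (EuclideanSpace ℝ (Fin 4)) (TangentSpace (𝓡 4) : M → Type _))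
      [g.HasLeviCivita] (hg : g.IsRiemannian) (p : M) (G : M → ℝ),
        (ContMDiffOn (𝓡 4) 𝓘(ℝ, ℝ) ∞ G {p}ᶜ ∧ (∀ x, x ≠ p → 0 < G x) ∧
          (∀ x, x ≠ p → g.scalarCurvature x * G x - 6 * g.dalembertian G x = 0) ∧
          Tendsto G (𝓝[≠] p) atTop) →
      ∀ (a r : ℝ), 0 < a → 0 < r →
        Metric.closedBall (extChartAt (𝓡 4) p p) r ⊆ (extChartAt (𝓡 4) p).target →
        (∀ y ∈ Metric.closedBall (extChartAt (𝓡 4) p p) r, ∀ X W : EuclideanSpace ℝ (Fin 4),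
          g.val ((extChartAt (𝓡 4) p).symm y)
            (mfderiv 𝓘(ℝ, EuclideanSpace ℝ (Fin 4)) (𝓡 4) (extChartAt (𝓡 4) p).symm y X)
            (mfderiv 𝓘(ℝ, EuclideanSpace ℝ (Fin 4)) (𝓡 4) (extChartAt (𝓡 4) p).symm y W) = ⟪X, W⟫) →
        (∀ y ∈ Metric.closedBall (extChartAt (𝓡 4) p p) r, y ≠ extChartAt (𝓡 4) p p →
          G ((extChartAt (𝓡 4) p).symm y) = a / ‖y - extChartAt (𝓡 4) p p‖ ^ 2) →
      ∃ C₁ C₂ : ℝ, ∀ (K : ℝ), 0 < K → ∀ (ψ : M → ℝ), ContMDiff (𝓡 4) 𝓘(ℝ, ℝ) ∞ ψ →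
        (∀ x, x ≠ p → ψ x = 4 * K * G x / (4 * K + G x)) → ψ p = 4 * K →
        ∫ x, (ψ x) ^ 4 ∂(riemannianMeasure (g.toContMDiffRiemannianMetric hg)) ≤ C₁ + C₂ * K ^ 2 := by
  intro hS0b M _ _ _ _ _ _ _ _ _ g _ hg p G hG a r ha hr hsub hflat hGa
  exact capMetricVolume_le g hg p G hG.1 hG.2.1 ha hr hsub hGa (hS0b M g hg p r hr hsub hflat)

end Summit.SmoothPoincare4.SmoothPoincare4.Theorems

end
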